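import Literature.RepresentationTheory.FiniteGroups.GL2ModularPrincipalSeriesLatticeUniquePID
import HarnessLib

/-!
# The lattice theorem for the tame principal-series type in `Subrepresentation` form (concrete carriers)

Topic `Literature/RepresentationTheory/FiniteGroups`, namespace `Literature.RepresentationTheory.FiniteGroups.GL2`.
Two plumbing definitions (`subrepAsSubmoduleEquiv`, `subrepQuotEquiv`) + THEOREMS; no named fact, no instance, no
notation, no `sorry`.  Sequel of `GL2ModularPrincipalSeriesLatticeUniquePID` ([EmertonGeeSavitt2015, Lemma 4.1.1]
applied to `Ind(χ₁ ⊗ χ₂)` of `GL₂(𝔽_p)`).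

WHY.  Mathlib's typeclass search does not build quotients `↥Λ ⧸ N` for `Λ : Submodule R[G] ρ.asModule` once the
carrier of `ρ` is a concrete type (`Pi`, `Finsupp`, `Submodule` subtypes …; the `AddCommGroup`/`Module` instances of
`Representation.asModule` are definitionally but not reducibly compatible there).  The group-ring statements of the
previous files are therefore only INSTANTIABLE on an abstract carrier.  Here the final theorem is restated with the
lattice a `Subrepresentation ρ₀` (an `R`-submodule stable under `GL₂(𝔽_p)`), its reduction the plain `R`-module
quotient `Λ/ϖΛ`, the group acting through representatives, and the socle hypothesis an `R`-linear equivariant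
injection of `Sym^r(k²)` — and it is instantiated on the CONCRETE coordinate model `coordRep χ₁ χ₂` on
`Option 𝔽_p → R`:

* `comap_subtype_pointwise_smul`, `subrepAsSubmoduleEquiv`, `subrepQuotEquiv` (+ `_mk`, `_symm_mk`),
  `coe_single_one_smul` — the identifications `Λ'.asSubmodule ≃ Λ'`, `(Λ/ϖΛ over R[G]) ≃ (Λ/ϖΛ over R)`;
* **`toSubmodule_eq_pow_smul_top_of_pid`** — the `Subrepresentation` form on any model `ρ₀ ≃ Fun_R(Ind(χ₁ ⊗ χ₂))`;
* **`subrepresentation_coordRep_eq_pow_smul_top`** — the concrete form: a `GL₂(𝔽_p)`-stable `R`-lattice of finite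
  index in `coordRep χ₁ χ₂` whose reduction has socle `⊆ {Sym^r ⊗ χ̄₁∘det}` is `ϖᶜ · (Option 𝔽_p → R)`.
-/

noncomputable section

namespace Literature.RepresentationTheory.FiniteGroups

namespace GL2

open Function Pointwise
open Literature.NumberTheory.Automorphic (TwistedQuotient.resScalars TwistedQuotient.resScalars_apply)

section SubrepForm

/-! ### The lattice theorem in `Subrepresentation` form (robust on concrete carriers)

Mathlib's typeclass search fails to build quotients `↥Λ ⧸ N` for `Λ : Submodule R[G] ρ.asModule` as soon as the
carrier of `ρ` is a concrete type (a `Pi` type, a `Finsupp`, a `Submodule` subtype, …): the `AddCommGroup`/`Module`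
instances of `Representation.asModule` are then not recognised as compatible at instance transparency (they are
definitionally equal).  The statements above are therefore phrased, and proved, over an ABSTRACT carrier `V₀`; to
make them usable on a concrete model we restate the final theorem with the lattice a `Subrepresentation ρ₀`
(an `R`-submodule stable under `GL₂(𝔽_p)`) and its reduction the plain `R`-module quotient `Λ/ϖΛ`, the group acting
through representatives — no module over the group ring appears in the hypotheses. -/

variable (p : ℕ) [Fact p.Prime] {R : Type} [CommRing R] [IsDomain R] [IsPrincipalIdealRing R] {k : Type} [Field k]
  [CharP k p] [Algebra R k] (χ₁ χ₂ : (ZMod p)ˣ →* Rˣ) {V₀ : Type} [AddCommGroup V₀] [Module R V₀]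
  {ρ₀ : Representation R (GL (Fin 2) (ZMod p)) V₀} (e₀ : ρ₀.Equiv (principalSeriesRep (ZMod p) χ₁ χ₂)) {r s : ℕ}

omit [Fact p.Prime] [IsDomain R] [IsPrincipalIdealRing R] in
/-- The reduction submodule `(ϖ • Λ) ∩ Λ ⊆ Λ` of an `R`-submodule is `ϖ • Λ`. [cite: EmertonGeeSavitt2015, Lemma 4.1.1] -/
theorem comap_subtype_pointwise_smul (ϖ : R) (L : Submodule R V₀) :
    (ϖ • L).comap L.subtype = ϖ • (⊤ : Submodule R ↥L) := by
  ext x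
  rw [Submodule.mem_comap, ← SetLike.mem_coe, Submodule.coe_pointwise_smul, Set.mem_smul_set, ← SetLike.mem_coe,
    Submodule.coe_pointwise_smul, Set.mem_smul_set]
  constructor
  · rintro ⟨y, hy, hyx⟩
    exact ⟨⟨y, hy⟩, Submodule.mem_top, Subtype.ext hyx⟩
  · rintro ⟨y, -, rfl⟩
    exact ⟨y, y.2, rfl⟩

omit [IsDomain R] [IsPrincipalIdealRing R] in
/-- The identity `↥(Λ'.asSubmodule) ≃ ↥Λ'.toSubmodule` (group-ring submodule vs `R`-submodule of a subrepresentation),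
`R`-linear. [cite: EmertonGeeSavitt2015, Lemma 4.1.1] -/
def subrepAsSubmoduleEquiv (Λ' : Subrepresentation ρ₀) :
    ↥(Subrepresentation.asSubmodule Λ') ≃ₗ[R] ↥Λ'.toSubmodule where
  toFun x := ⟨ρ₀.asModuleEquiv (x : ρ₀.asModule), x.2⟩
  invFun y := ⟨ρ₀.asModuleEquiv.symm (y : V₀), y.2⟩
  left_inv _ := rfl
  right_inv _ := rfl
  map_add' _ _ := rfl
  map_smul' _ _ := rfl

omit [IsDomain R] [IsPrincipalIdealRing R] in
/-- **The reduction `Λ/ϖΛ` over the group ring IS the plain `R`-module reduction** of the underlying `R`-lattice: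
an `R`-linear isomorphism (identity on representatives). [cite: EmertonGeeSavitt2015, Lemma 4.1.1] -/
def subrepQuotEquiv (ϖ : R) (Λ' : Subrepresentation ρ₀) :
    (↥(Subrepresentation.asSubmodule Λ') ⧸
        (ϖ • Subrepresentation.asSubmodule Λ').comap (Subrepresentation.asSubmodule Λ').subtype) ≃ₗ[R]
      (↥Λ'.toSubmodule ⧸ (ϖ • Λ'.toSubmodule).comap Λ'.toSubmodule.subtype) :=
  (Submodule.Quotient.restrictScalarsEquiv R
      ((ϖ • Subrepresentation.asSubmodule Λ').comap (Subrepresentation.asSubmodule Λ').subtype)).symm.trans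
    (Submodule.Quotient.equiv _ _ (subrepAsSubmoduleEquiv p Λ') (by
      rw [restrictScalars_comap_pointwise_smul p ϖ (Subrepresentation.asSubmodule Λ'), comap_subtype_pointwise_smul,
        Submodule.map_pointwise_smul, Submodule.map_top, LinearEquiv.range]))

omit [IsDomain R] [IsPrincipalIdealRing R] in
/-- Unfolding on representatives. [cite: EmertonGeeSavitt2015, Lemma 4.1.1] -/
theorem subrepQuotEquiv_mk (ϖ : R) (Λ' : Subrepresentation ρ₀) (x : ↥(Subrepresentation.asSubmodule Λ')) :
    subrepQuotEquiv p ϖ Λ' (Submodule.Quotient.mk x) =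
      Submodule.Quotient.mk (subrepAsSubmoduleEquiv p Λ' x) := rfl

omit [IsDomain R] [IsPrincipalIdealRing R] in
/-- Unfolding of the inverse on representatives. [cite: EmertonGeeSavitt2015, Lemma 4.1.1] -/
theorem subrepQuotEquiv_symm_mk (ϖ : R) (Λ' : Subrepresentation ρ₀) (y : ↥Λ'.toSubmodule) :
    (subrepQuotEquiv p ϖ Λ').symm (Submodule.Quotient.mk y) =
      Submodule.Quotient.mk ((subrepAsSubmoduleEquiv p Λ').symm y) := by
  rw [LinearEquiv.symm_apply_eq, subrepQuotEquiv_mk, LinearEquiv.apply_symm_apply]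

omit [IsDomain R] [IsPrincipalIdealRing R] in
/-- The group-ring action on `↥(Λ'.asSubmodule)` through representatives: `(g · x) = ρ₀ g x`. [cite: EmertonGeeSavitt2015, Lemma 4.1.1] -/
theorem coe_single_one_smul (Λ' : Subrepresentation ρ₀) (g : GL (Fin 2) (ZMod p))
    (x : ↥(Subrepresentation.asSubmodule Λ')) :
    subrepAsSubmoduleEquiv p Λ'
        (MonoidAlgebra.single g (1 : R) • x : ↥(Subrepresentation.asSubmodule Λ')) =
      ⟨ρ₀ g (subrepAsSubmoduleEquiv p Λ' x : V₀), Λ'.apply_mem_toSubmodule g (subrepAsSubmoduleEquiv p Λ' x).2⟩ := by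
  refine Subtype.ext ?_
  change ρ₀.asModuleEquiv (MonoidAlgebra.single g (1 : R) • (x : ρ₀.asModule)) = _
  rw [Representation.single_smul, one_smul]
  rfl

include e₀ in
/-- **EGS Lemma 4.1.1 for the tame principal-series type — `Subrepresentation` form** (R a PID with finite residue
field `k = R/ϖ`, e.g. `ℤ_p → 𝔽_p`; usable on CONCRETE models `ρ₀`).  Let `Λ' ⊆ ρ₀` be an `R`-submodule stable under
`GL₂(𝔽_p)` with `ϖᵐ ρ₀ ⊆ Λ'`, and suppose every nonzero `GL₂(𝔽_p)`-stable `R`-submodule `N` of the plain reduction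
`Λ'/ϖΛ'` receives an injective `R`-linear map from `Sym^r(k²)` with image in `N`, equivariant for
`Sym^r ⊗ (χ̄₁ ∘ det)` (equivariance through representatives).  Then `Λ' = ϖᶜ ρ₀`. [cite: EmertonGeeSavitt2015, Lemma 4.1.1] -/
theorem toSubmodule_eq_pow_smul_top_of_pid [Finite k] {ϖ : R} (hϖ : ϖ ≠ 0)
    (hsepR : ∀ a : R, (∀ j : ℕ, ϖ ^ j ∣ a) → a = 0)
    (hker : ∀ a : R, algebraMap R k a = 0 ↔ ϖ ∣ a) (hsurj : Surjective (algebraMap R k))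
    (hχne : reduceChar k χ₁ ≠ reduceChar k χ₂)
    (hχ : ∀ a : (ZMod p)ˣ, (reduceChar k χ₂ a : k) = (reduceChar k χ₁ a : k) * ZMod.castHom (dvd_refl p) k a ^ r)
    (hrs : r + s = p - 1)
    (Λ' : Subrepresentation ρ₀) {m : ℕ} (hm : ∀ v : V₀, ϖ ^ m • v ∈ Λ')
    (hsoc : ∀ N : Submodule R (↥Λ'.toSubmodule ⧸ (ϖ • Λ'.toSubmodule).comap Λ'.toSubmodule.subtype),
      (∀ (g : GL (Fin 2) (ZMod p)) (x : ↥Λ'.toSubmodule), Submodule.Quotient.mk x ∈ N →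
        Submodule.Quotient.mk (⟨ρ₀ g (x : V₀), Λ'.apply_mem_toSubmodule g x.2⟩ : ↥Λ'.toSubmodule) ∈ N) →
      N ≠ ⊥ →
      ∃ f : ↥(MvPolynomial.homogeneousSubmodule (Fin 2) k r) →ₗ[R]
          (↥Λ'.toSubmodule ⧸ (ϖ • Λ'.toSubmodule).comap Λ'.toSubmodule.subtype),
        Injective f ∧ LinearMap.range f ≤ N ∧
        ∀ (g : GL (Fin 2) (ZMod p)) (φ : ↥(MvPolynomial.homogeneousSubmodule (Fin 2) k r)) (x : ↥Λ'.toSubmodule),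
          Submodule.Quotient.mk x = f φ →
          Submodule.Quotient.mk (⟨ρ₀ g (x : V₀), Λ'.apply_mem_toSubmodule g x.2⟩ : ↥Λ'.toSubmodule) =
            f (symPowTwist (ZMod.castHom (dvd_refl p) k) (reduceChar k χ₁) r g φ)) :
    ∃ c : ℕ, Λ'.toSubmodule = ϖ ^ c • (⊤ : Submodule R V₀) := by
  classical
  -- the lattice over the group ring
  let Λ : Submodule (MonoidAlgebra R (GL (Fin 2) (ZMod p))) ρ₀.asModule := Subrepresentation.asSubmodule Λ'
  have hmΛ : ϖ ^ m • (⊤ : Submodule (MonoidAlgebra R (GL (Fin 2) (ZMod p))) ρ₀.asModule) ≤ Λ := by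
    intro x hx
    rw [← SetLike.mem_coe, Submodule.coe_pointwise_smul, Set.mem_smul_set] at hx
    obtain ⟨y, -, rfl⟩ := hx
    exact hm (ρ₀.asModuleEquiv y)
  let θ := subrepQuotEquiv p ϖ Λ'
  let ι := subrepAsSubmoduleEquiv p Λ'
  -- the socle hypothesis over the group ring
  have hsocA : ∀ NA : Submodule (MonoidAlgebra R (GL (Fin 2) (ZMod p)))
      (↥Λ ⧸ (ϖ • Λ).comap Λ.subtype), NA ≠ ⊥ →
      ∃ F : (TwistedQuotient.resScalars R
          (symPowTwist (ZMod.castHom (dvd_refl p) k) (reduceChar k χ₁) r)).asModule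
            →ₗ[MonoidAlgebra R (GL (Fin 2) (ZMod p))] ↥NA, Injective F := by
    intro NA hNA
    -- transport `NA` to a `G`-stable `R`-submodule `N` of the plain reduction
    let N : Submodule R (↥Λ'.toSubmodule ⧸ (ϖ • Λ'.toSubmodule).comap Λ'.toSubmodule.subtype) :=
      (NA.restrictScalars R).map θ.toLinearMap
    have hNmem : ∀ q, q ∈ N ↔ θ.symm q ∈ NA := by
      intro q
      constructor
      · rintro ⟨q', hq', rfl⟩
        rw [LinearEquiv.coe_toLinearMap, LinearEquiv.symm_apply_apply]; exact hq'
      · intro hq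
        exact ⟨θ.symm q, hq, by rw [LinearEquiv.coe_toLinearMap, LinearEquiv.apply_symm_apply]⟩
    have hstab : ∀ (g : GL (Fin 2) (ZMod p)) (x : ↥Λ'.toSubmodule), Submodule.Quotient.mk x ∈ N →
        Submodule.Quotient.mk (⟨ρ₀ g (x : V₀), Λ'.apply_mem_toSubmodule g x.2⟩ : ↥Λ'.toSubmodule) ∈ N := by
      intro g x hx
      rw [hNmem, subrepQuotEquiv_symm_mk] at hx ⊢
      have h := NA.smul_mem (MonoidAlgebra.single g (1 : R)) hx
      rw [← Submodule.Quotient.mk_smul] at h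
      convert h using 2
      apply ι.injective
      rw [coe_single_one_smul, LinearEquiv.apply_symm_apply, LinearEquiv.apply_symm_apply]
    have hNne : N ≠ ⊥ := by
      intro hN
      apply hNA
      rw [eq_bot_iff]
      intro q hq
      have : θ q ∈ N := ⟨q, hq, rfl⟩
      rw [hN, Submodule.mem_bot, LinearEquiv.map_eq_zero_iff] at this
      rw [this]; exact Submodule.zero_mem _
    obtain ⟨f, hfi, hfN, hfeq⟩ := hsoc N hstab hNne
    -- the `R`-linear candidate `F₀ = θ⁻¹ ∘ f ∘ (asModule identification)`
    let σ := symPowTwist (ZMod.castHom (dvd_refl p) k) (reduceChar k χ₁) r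
    let F₀ : (TwistedQuotient.resScalars R σ).asModule →ₗ[R] (↥Λ ⧸ (ϖ • Λ).comap Λ.subtype) :=
      (θ.symm.toLinearMap.comp f).comp (TwistedQuotient.resScalars R σ).asModuleEquiv.toLinearMap
    have hF₀ : ∀ φ, F₀ φ = θ.symm (f ((TwistedQuotient.resScalars R σ).asModuleEquiv φ)) := fun _ => rfl
    -- it is linear over the group ring
    have hF₀lin : ∀ (a : MonoidAlgebra R (GL (Fin 2) (ZMod p))) φ, F₀ (a • φ) = a • F₀ φ := by
      intro a
      induction a using MonoidAlgebra.induction_on with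
      | hM g =>
        intro φ
        obtain ⟨x, hx⟩ := Submodule.Quotient.mk_surjective _ (f ((TwistedQuotient.resScalars R σ).asModuleEquiv φ))
        have hφ : (TwistedQuotient.resScalars R σ).asModuleEquiv (MonoidAlgebra.of R _ g • φ) =
            σ g ((TwistedQuotient.resScalars R σ).asModuleEquiv φ) := by
          rw [MonoidAlgebra.of_apply, Representation.asModuleEquiv_map_smul, Representation.asAlgebraHom_single,
            one_smul]
          rfl
        rw [hF₀, hF₀, hφ, ← hfeq g _ x hx, ← hx, subrepQuotEquiv_symm_mk, subrepQuotEquiv_symm_mk,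
          MonoidAlgebra.of_apply, ← Submodule.Quotient.mk_smul]
        congr 1
        apply ι.injective
        rw [coe_single_one_smul, LinearEquiv.apply_symm_apply, LinearEquiv.apply_symm_apply]
      | hadd a b ha hb => intro φ; rw [add_smul, map_add, ha, hb, add_smul]
      | hsmul c a ha => intro φ; rw [smul_assoc, LinearMap.map_smul, ha, smul_assoc]
    let F₁ : (TwistedQuotient.resScalars R σ).asModule →ₗ[MonoidAlgebra R (GL (Fin 2) (ZMod p))]
        (↥Λ ⧸ (ϖ • Λ).comap Λ.subtype) :=
      { toFun := F₀, map_add' := F₀.map_add, map_smul' := hF₀lin }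
    have hF₁mem : ∀ φ, F₁ φ ∈ NA := fun φ => (hNmem _).mp (hfN (LinearMap.mem_range_self f _))
    refine ⟨F₁.codRestrict NA hF₁mem, fun φ ψ h => ?_⟩
    have h' : F₀ φ = F₀ ψ := congrArg Subtype.val h
    rw [hF₀, hF₀] at h'
    exact (TwistedQuotient.resScalars R σ).asModuleEquiv.injective (hfi (θ.symm.injective h'))
  -- apply the group-ring form
  obtain ⟨c, hc⟩ := exists_eq_pow_smul_top_of_pid p χ₁ χ₂ e₀ hϖ hsepR hker hsurj hχne hχ hrs Λ hmΛ hsocA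
  refine ⟨c, ?_⟩
  ext v
  have h1 : v ∈ Λ'.toSubmodule ↔ (ρ₀.asModuleEquiv.symm v) ∈ Λ := Iff.rfl
  rw [h1, hc, ← SetLike.mem_coe, Submodule.coe_pointwise_smul, Set.mem_smul_set, ← SetLike.mem_coe,
    Submodule.coe_pointwise_smul, Set.mem_smul_set]
  constructor
  · rintro ⟨y, -, hy⟩
    exact ⟨ρ₀.asModuleEquiv y, Submodule.mem_top, by
      apply ρ₀.asModuleEquiv.symm.injective
      rw [← hy, LinearEquiv.map_smul, LinearEquiv.symm_apply_apply]⟩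
  · rintro ⟨y, -, rfl⟩
    exact ⟨ρ₀.asModuleEquiv.symm y, Submodule.mem_top, by rw [LinearEquiv.map_smul]⟩

/-- **EGS Lemma 4.1.1 for the tame principal-series type — concrete form in Bruhat coordinates.**  `R` a PID with
finite residue field `k = R/ϖ` (e.g. `ℤ_p → 𝔽_p`), `χ̄₁ ≠ χ̄₂ = χ̄₁ε^r`, `r + s = p − 1`.  In the coordinate model
`coordRep χ₁ χ₂` of `Fun_R(Ind(χ₁ ⊗ χ₂))` on `Option 𝔽_p → R` (`≃` the function model by `coordEquiv`): every
`GL₂(𝔽_p)`-stable `R`-submodule `Λ'` of finite index (`ϖᵐ · (Option 𝔽_p → R) ⊆ Λ'`) such that every nonzero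
`GL₂(𝔽_p)`-stable `R`-submodule of `Λ'/ϖΛ'` receives `Sym^r(k²) ⊗ (χ̄₁ ∘ det)` injectively and equivariantly is
`ϖᶜ · (Option 𝔽_p → R)` — the standard lattice is, up to homothety, the unique stable lattice whose reduction has
socle `Sym^r ⊗ χ̄₁∘det`.  (The function-model carrier `↥(coindV …)` itself does not support the quotient
`Λ'/ϖΛ'` by typeclass search; the coordinate model does.) [cite: EmertonGeeSavitt2015, Lemma 4.1.1] -/
theorem subrepresentation_coordRep_eq_pow_smul_top [Finite k] {ϖ : R} (hϖ : ϖ ≠ 0)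
    (hsepR : ∀ a : R, (∀ j : ℕ, ϖ ^ j ∣ a) → a = 0)
    (hker : ∀ a : R, algebraMap R k a = 0 ↔ ϖ ∣ a) (hsurj : Surjective (algebraMap R k))
    (hχne : reduceChar k χ₁ ≠ reduceChar k χ₂)
    (hχ : ∀ a : (ZMod p)ˣ, (reduceChar k χ₂ a : k) = (reduceChar k χ₁ a : k) * ZMod.castHom (dvd_refl p) k a ^ r)
    (hrs : r + s = p - 1)
    (Λ' : Subrepresentation (coordRep χ₁ χ₂)) {m : ℕ}
    (hm : ∀ v : Option (ZMod p) → R, ϖ ^ m • v ∈ Λ')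
    (hsoc : ∀ N : Submodule R (↥Λ'.toSubmodule ⧸ (ϖ • Λ'.toSubmodule).comap Λ'.toSubmodule.subtype),
      (∀ (g : GL (Fin 2) (ZMod p)) (x : ↥Λ'.toSubmodule), Submodule.Quotient.mk x ∈ N →
        Submodule.Quotient.mk (⟨coordRep χ₁ χ₂ g x, Λ'.apply_mem_toSubmodule g x.2⟩ : ↥Λ'.toSubmodule) ∈ N) →
      N ≠ ⊥ →
      ∃ f : ↥(MvPolynomial.homogeneousSubmodule (Fin 2) k r) →ₗ[R]
          (↥Λ'.toSubmodule ⧸ (ϖ • Λ'.toSubmodule).comap Λ'.toSubmodule.subtype),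
        Injective f ∧ LinearMap.range f ≤ N ∧
        ∀ (g : GL (Fin 2) (ZMod p)) (φ : ↥(MvPolynomial.homogeneousSubmodule (Fin 2) k r)) (x : ↥Λ'.toSubmodule),
          Submodule.Quotient.mk x = f φ →
          Submodule.Quotient.mk (⟨coordRep χ₁ χ₂ g x, Λ'.apply_mem_toSubmodule g x.2⟩ : ↥Λ'.toSubmodule) =
            f (symPowTwist (ZMod.castHom (dvd_refl p) k) (reduceChar k χ₁) r g φ)) :
    ∃ c : ℕ, Λ'.toSubmodule = ϖ ^ c • (⊤ : Submodule R (Option (ZMod p) → R)) :=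
  toSubmodule_eq_pow_smul_top_of_pid p χ₁ χ₂ (coordEquiv χ₁ χ₂).symm hϖ hsepR hker hsurj hχne hχ hrs Λ' hm hsoc

end SubrepForm

end GL2

end Literature.RepresentationTheory.FiniteGroups
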